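import Mathlib
import HarnessLib
import Summits.NavierStokesRegularity.NavierStokesRegularity.Theorems.RellichScarScarRigidityVorticityDefectIBP

/-!
# Crux `PoloidalWindowRigidity` (stmt-NavierStokesRegularity-19708) — negative side: in the POLYNOMIAL SECTOR the (TH) vertical
# momentum law `(E)` is load-bearing (`polySector_false_without_thLaw`)

Negative-side support (refuter seat ns-regularity-refuter1, K-60; D-0081 §C) for K2-p5's crux workfile
`Cruxes/PoloidalWindowRigidity/PolySector.lean` (THEOREM P = `PolySector_NoTwistingTHGerm`: the binders of `stub_localTHEmpty` /
`hempty` plus the sector hypothesis `IsHorizPolynomialOn U u`, conclusion `False`).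

**`polySector_false_without_thLaw`.**  Delete from `PolySector_NoTwistingTHGerm` the single dynamic hypothesis — the (TH) vertical
momentum law `(1−μ)(∂ₜu₂ + u·∇u₂ − Δu₂) = A + (μ_t − μ_zz)u₂ + (μ_z/2)u₂² − 2μ_z∂₂u₂` — and keep EVERYTHING else verbatim (analyticity,
poloidality, incompressibility, proportional shear, the polynomial-sector hypothesis — written out, i.e. `IsHorizPolynomialOn` δ-unfolded —
the twist pin, `μ ∉ {0,1}` AND the slope-gradient pin `∂_zμ ≠ 0`): the resulting statement is FALSE.  Witness (memo POLY-SECTOR-K2p5.md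
§6, "kinematic twisting germ", made explicit): the steady polynomial field
`u(y) = (3/2·y₀²y₁y₂² − y₁y₂⁵/5, y₀³y₂²/2 − y₀y₂⁵/5, y₀³y₁ − y₀y₁y₂³) = (∇_hφ, φ_z/μ)`, `φ = y₀³y₁y₂²/2 − y₀y₁y₂⁵/5`, slope
`μ(t,z) = z`, on `U = ℝ × ℝ³`, base point `p₀ = (0, (1,1,2))`: poloidal, divergence free, `∂₂u_b = y₂·∂_b u₂` (`b = 0,1`), every
component a polynomial in `(y₀,y₁)` on every slice, twist `6y₀³y₁y₂² = 24 ≠ 0` at `p₀`, `μ(p₀) = 2 ∉ {0,1}`, `∂_zμ = 1 ≠ 0`.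

So the kinematic (TH) system is NOT empty in the polynomial sector even with `∂_zμ ≠ 0`: THEOREM P, if true, is a statement about the
dynamics `(E)` (complementing `…Negative.expPolySector_false_without_slopeGradient`, which shows the slope-gradient pin is load-bearing in
the exponential-polynomial sector).  Information for the K2 census and for readers of the memo's eliminations.

WHAT THIS IS NOT: not a refutation of THEOREM P, of `stub_localTHEmpty`, of the line, or of anything about Navier–Stokes regularity (the
witness is not a Navier–Stokes solution and violates the deleted law by design) — explicit vector calculus for a kinematic witness. [folklore]
-/

noncomputable section
-- the summit and its single sub-problem share the name (CONVENTIONS §1), as in every Theorems file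
set_option linter.dupNamespace false

namespace Summit.NavierStokesRegularity.NavierStokesRegularity.Theorems.PoloidalWindowRigidity.Negative

open Set Function Filter Topology Real InnerProductSpace WithLp
open scoped ContDiff

namespace PolyTwist

/-- The polynomial twisting germ as a combination of the standard basis vectors. [folklore] -/
theorem field_eq :
    (fun y : EuclideanSpace ℝ (Fin 3) => (toLp 2 ![3 / 2 * y 0 ^ 2 * y 1 * y 2 ^ 2 - 1 / 5 * y 1 * y 2 ^ 5,
        1 / 2 * y 0 ^ 3 * y 2 ^ 2 - 1 / 5 * y 0 * y 2 ^ 5, y 0 ^ 3 * y 1 - y 0 * y 1 * y 2 ^ 3] : EuclideanSpace ℝ (Fin 3))) =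
      fun y => (3 / 2 * y 0 ^ 2 * y 1 * y 2 ^ 2 - 1 / 5 * y 1 * y 2 ^ 5) • EuclideanSpace.single (0 : Fin 3) (1 : ℝ) +
        (1 / 2 * y 0 ^ 3 * y 2 ^ 2 - 1 / 5 * y 0 * y 2 ^ 5) • EuclideanSpace.single (1 : Fin 3) (1 : ℝ) +
        (y 0 ^ 3 * y 1 - y 0 * y 1 * y 2 ^ 3) • EuclideanSpace.single (2 : Fin 3) (1 : ℝ) := by
  funext y; ext i; fin_cases i <;> simp

/-- The germ is smooth (indeed polynomial). [folklore] -/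
theorem contDiff_field {n : WithTop ℕ∞} :
    ContDiff ℝ n (fun y : EuclideanSpace ℝ (Fin 3) => (toLp 2 ![3 / 2 * y 0 ^ 2 * y 1 * y 2 ^ 2 - 1 / 5 * y 1 * y 2 ^ 5,
        1 / 2 * y 0 ^ 3 * y 2 ^ 2 - 1 / 5 * y 0 * y 2 ^ 5, y 0 ^ 3 * y 1 - y 0 * y 1 * y 2 ^ 3] : EuclideanSpace ℝ (Fin 3))) := by
  rw [field_eq]
  have h0 : ContDiff ℝ n (fun y : EuclideanSpace ℝ (Fin 3) => y 0) :=
    (EuclideanSpace.proj (0 : Fin 3) : EuclideanSpace ℝ (Fin 3) →L[ℝ] ℝ).contDiff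
  have h1 : ContDiff ℝ n (fun y : EuclideanSpace ℝ (Fin 3) => y 1) :=
    (EuclideanSpace.proj (1 : Fin 3) : EuclideanSpace ℝ (Fin 3) →L[ℝ] ℝ).contDiff
  have h2 : ContDiff ℝ n (fun y : EuclideanSpace ℝ (Fin 3) => y 2) :=
    (EuclideanSpace.proj (2 : Fin 3) : EuclideanSpace ℝ (Fin 3) →L[ℝ] ℝ).contDiff
  exact ((((((contDiff_const.mul (h0.pow 2)).mul h1).mul (h2.pow 2)).sub ((contDiff_const.mul h1).mul (h2.pow 5))).smul
      contDiff_const).add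
    ((((contDiff_const.mul (h0.pow 3)).mul (h2.pow 2)).sub ((contDiff_const.mul h0).mul (h2.pow 5))).smul contDiff_const)).add
    ((((h0.pow 3).mul h1).sub ((h0.mul h1).mul (h2.pow 3))).smul contDiff_const)

/-- The directional derivative in coordinates, `(Du(x)h)ᵢ = Σⱼ hⱼ ∂ⱼuᵢ`, with the explicit Jacobian. [folklore] -/
theorem fderiv_field_apply (x h : EuclideanSpace ℝ (Fin 3)) (i : Fin 3) :
    fderiv ℝ (fun y : EuclideanSpace ℝ (Fin 3) => (toLp 2 ![3 / 2 * y 0 ^ 2 * y 1 * y 2 ^ 2 - 1 / 5 * y 1 * y 2 ^ 5,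
        1 / 2 * y 0 ^ 3 * y 2 ^ 2 - 1 / 5 * y 0 * y 2 ^ 5, y 0 ^ 3 * y 1 - y 0 * y 1 * y 2 ^ 3] : EuclideanSpace ℝ (Fin 3))) x h i =
      h 0 * (![3 * x 0 * x 1 * x 2 ^ 2, 3 / 2 * x 0 ^ 2 * x 2 ^ 2 - 1 / 5 * x 2 ^ 5, 3 * x 0 ^ 2 * x 1 - x 1 * x 2 ^ 3] i) +
      h 1 * (![3 / 2 * x 0 ^ 2 * x 2 ^ 2 - 1 / 5 * x 2 ^ 5, 0, x 0 ^ 3 - x 0 * x 2 ^ 3] i) +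
      h 2 * (![3 * x 0 ^ 2 * x 1 * x 2 - x 1 * x 2 ^ 4, x 0 ^ 3 * x 2 - x 0 * x 2 ^ 4, -(3 * x 0 * x 1 * x 2 ^ 2)] i) := by
  rw [field_eq]
  have h0 := Theorems.RellichScarScarRigidity.hasFDerivAt_euclidean_coord 0 x
  have h1 := Theorems.RellichScarScarRigidity.hasFDerivAt_euclidean_coord 1 x
  have h2 := Theorems.RellichScarScarRigidity.hasFDerivAt_euclidean_coord 2 x
  have H := ((((((h0.pow 2).const_mul (3 / 2)).fun_mul h1).fun_mul (h2.pow 2)).fun_sub ((h1.const_mul (1 / 5)).fun_mul (h2.pow 5))).smul_const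
      (EuclideanSpace.single (0 : Fin 3) (1 : ℝ))).fun_add
    (((((h0.pow 3).const_mul (1 / 2)).fun_mul (h2.pow 2)).fun_sub ((h0.const_mul (1 / 5)).fun_mul (h2.pow 5))).smul_const
      (EuclideanSpace.single (1 : Fin 3) (1 : ℝ))) |>.fun_add
    ((((h0.pow 3).fun_mul h1).fun_sub ((h0.fun_mul h1).fun_mul (h2.pow 3))).smul_const (EuclideanSpace.single (2 : Fin 3) (1 : ℝ)))
  rw [H.fderiv]
  fin_cases i
  · simp; ring
  · simp; ring
  · simp; ring

/-- Partial derivatives `∂ⱼuᵢ`. [folklore] -/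
theorem fderiv_field_single (x : EuclideanSpace ℝ (Fin 3)) (j i : Fin 3) :
    fderiv ℝ (fun y : EuclideanSpace ℝ (Fin 3) => (toLp 2 ![3 / 2 * y 0 ^ 2 * y 1 * y 2 ^ 2 - 1 / 5 * y 1 * y 2 ^ 5,
        1 / 2 * y 0 ^ 3 * y 2 ^ 2 - 1 / 5 * y 0 * y 2 ^ 5, y 0 ^ 3 * y 1 - y 0 * y 1 * y 2 ^ 3] : EuclideanSpace ℝ (Fin 3))) x
        (EuclideanSpace.single j (1 : ℝ)) i =
      ![![3 * x 0 * x 1 * x 2 ^ 2, 3 / 2 * x 0 ^ 2 * x 2 ^ 2 - 1 / 5 * x 2 ^ 5, 3 * x 0 ^ 2 * x 1 - x 1 * x 2 ^ 3],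
        ![3 / 2 * x 0 ^ 2 * x 2 ^ 2 - 1 / 5 * x 2 ^ 5, 0, x 0 ^ 3 - x 0 * x 2 ^ 3],
        ![3 * x 0 ^ 2 * x 1 * x 2 - x 1 * x 2 ^ 4, x 0 ^ 3 * x 2 - x 0 * x 2 ^ 4, -(3 * x 0 * x 1 * x 2 ^ 2)]] j i := by
  rw [fderiv_field_apply]
  fin_cases j <;> fin_cases i <;> simp

/-- The vertical stretching `∂₂u₂ = −3y₀y₁y₂²` as a function. [folklore] -/
theorem dz_field_two_eq :
    (fun x : EuclideanSpace ℝ (Fin 3) => fderiv ℝ (fun y : EuclideanSpace ℝ (Fin 3) =>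
        (toLp 2 ![3 / 2 * y 0 ^ 2 * y 1 * y 2 ^ 2 - 1 / 5 * y 1 * y 2 ^ 5,
          1 / 2 * y 0 ^ 3 * y 2 ^ 2 - 1 / 5 * y 0 * y 2 ^ 5, y 0 ^ 3 * y 1 - y 0 * y 1 * y 2 ^ 3] : EuclideanSpace ℝ (Fin 3))) x
        (EuclideanSpace.single 2 (1 : ℝ)) 2) =
      fun x => -(3 * x 0 * x 1 * x 2 ^ 2) := by
  funext x; rw [fderiv_field_single]; simp

/-- **The twist** `∂₀(∂₂u₂)·∂₁u₂ − ∂₁(∂₂u₂)·∂₀u₂ = 6y₀³y₁y₂²`. [folklore] -/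
theorem twist_field (x : EuclideanSpace ℝ (Fin 3)) :
    fderiv ℝ (fun z : EuclideanSpace ℝ (Fin 3) => fderiv ℝ (fun y : EuclideanSpace ℝ (Fin 3) =>
        (toLp 2 ![3 / 2 * y 0 ^ 2 * y 1 * y 2 ^ 2 - 1 / 5 * y 1 * y 2 ^ 5,
          1 / 2 * y 0 ^ 3 * y 2 ^ 2 - 1 / 5 * y 0 * y 2 ^ 5, y 0 ^ 3 * y 1 - y 0 * y 1 * y 2 ^ 3] : EuclideanSpace ℝ (Fin 3))) z
        (EuclideanSpace.single 2 (1 : ℝ)) 2) x (EuclideanSpace.single 0 (1 : ℝ)) *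
        fderiv ℝ (fun y : EuclideanSpace ℝ (Fin 3) =>
          (toLp 2 ![3 / 2 * y 0 ^ 2 * y 1 * y 2 ^ 2 - 1 / 5 * y 1 * y 2 ^ 5,
            1 / 2 * y 0 ^ 3 * y 2 ^ 2 - 1 / 5 * y 0 * y 2 ^ 5, y 0 ^ 3 * y 1 - y 0 * y 1 * y 2 ^ 3] : EuclideanSpace ℝ (Fin 3))) x
          (EuclideanSpace.single 1 (1 : ℝ)) 2 -
      fderiv ℝ (fun z : EuclideanSpace ℝ (Fin 3) => fderiv ℝ (fun y : EuclideanSpace ℝ (Fin 3) =>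
        (toLp 2 ![3 / 2 * y 0 ^ 2 * y 1 * y 2 ^ 2 - 1 / 5 * y 1 * y 2 ^ 5,
          1 / 2 * y 0 ^ 3 * y 2 ^ 2 - 1 / 5 * y 0 * y 2 ^ 5, y 0 ^ 3 * y 1 - y 0 * y 1 * y 2 ^ 3] : EuclideanSpace ℝ (Fin 3))) z
        (EuclideanSpace.single 2 (1 : ℝ)) 2) x (EuclideanSpace.single 1 (1 : ℝ)) *
        fderiv ℝ (fun y : EuclideanSpace ℝ (Fin 3) =>
          (toLp 2 ![3 / 2 * y 0 ^ 2 * y 1 * y 2 ^ 2 - 1 / 5 * y 1 * y 2 ^ 5,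
            1 / 2 * y 0 ^ 3 * y 2 ^ 2 - 1 / 5 * y 0 * y 2 ^ 5, y 0 ^ 3 * y 1 - y 0 * y 1 * y 2 ^ 3] : EuclideanSpace ℝ (Fin 3))) x
          (EuclideanSpace.single 0 (1 : ℝ)) 2 =
      6 * x 0 ^ 3 * x 1 * x 2 ^ 2 := by
  rw [dz_field_two_eq, fderiv_field_single, fderiv_field_single]
  have h0 := Theorems.RellichScarScarRigidity.hasFDerivAt_euclidean_coord 0 x
  have h1 := Theorems.RellichScarScarRigidity.hasFDerivAt_euclidean_coord 1 x
  have h2 := Theorems.RellichScarScarRigidity.hasFDerivAt_euclidean_coord 2 x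
  have H := (((h0.const_mul 3).fun_mul h1).fun_mul (h2.pow 2)).fun_neg
  rw [H.fderiv]
  simp
  ring

end PolyTwist

open PolyTwist in
/-- **THEOREM P needs the dynamics**: `PolySector_NoTwistingTHGerm` (K2-p5, `Cruxes/PoloidalWindowRigidity/PolySector.lean`) with its
(TH) vertical-momentum-law hypothesis DELETED — everything else verbatim, the sector hypothesis `IsHorizPolynomialOn U u` written out —
is FALSE: the polynomial twisting germ `u = (3/2·y₀²y₁y₂² − y₁y₂⁵/5, y₀³y₂²/2 − y₀y₂⁵/5, y₀³y₁ − y₀y₁y₂³)`, `μ(t,z) = z`, `A ≡ 0`,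
`U = univ`, `p₀ = (0,(1,1,2))` satisfies every remaining hypothesis (twist `24`, `μ = 2`, `∂_zμ = 1`). [folklore] -/
theorem polySector_false_without_thLaw :
    ¬ (∀ (u : ℝ → EuclideanSpace ℝ (Fin 3) → EuclideanSpace ℝ (Fin 3)) (μ A : ℝ → ℝ → ℝ)
        (U : Set (ℝ × EuclideanSpace ℝ (Fin 3))) (p₀ : ℝ × EuclideanSpace ℝ (Fin 3)),
        IsOpen U → p₀ ∈ U →
        AnalyticOnNhd ℝ (Function.uncurry u) U →
        (∀ p ∈ U, AnalyticAt ℝ (Function.uncurry μ) (p.1, p.2 2)) →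
        (∀ p ∈ U, AnalyticAt ℝ (Function.uncurry A) (p.1, p.2 2)) →
        (∀ p ∈ U, fderiv ℝ (u p.1) p.2 (EuclideanSpace.single 0 1) 1 =
          fderiv ℝ (u p.1) p.2 (EuclideanSpace.single 1 1) 0) →
        (∀ p ∈ U, fderiv ℝ (u p.1) p.2 (EuclideanSpace.single 0 1) 0 + fderiv ℝ (u p.1) p.2 (EuclideanSpace.single 1 1) 1 +
          fderiv ℝ (u p.1) p.2 (EuclideanSpace.single 2 1) 2 = 0) →
        (∀ p ∈ U, ∀ b : Fin 3, b ≠ 2 →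
          fderiv ℝ (u p.1) p.2 (EuclideanSpace.single 2 1) b =
            μ p.1 (p.2 2) * fderiv ℝ (u p.1) p.2 (EuclideanSpace.single b 1) 2) →
        -- the sector hypothesis `IsHorizPolynomialOn U u`, unfolded
        (∀ p ∈ U, ∀ i : Fin 3, ∃ P : MvPolynomial (Fin 2) ℝ, ∀ q ∈ U, q.1 = p.1 → q.2 2 = p.2 2 →
          u q.1 q.2 i = MvPolynomial.eval ![q.2 0, q.2 1] P) →
        fderiv ℝ (fun y => fderiv ℝ (u p₀.1) y (EuclideanSpace.single 2 1) 2) p₀.2 (EuclideanSpace.single 0 1) *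
              fderiv ℝ (u p₀.1) p₀.2 (EuclideanSpace.single 1 1) 2 -
            fderiv ℝ (fun y => fderiv ℝ (u p₀.1) y (EuclideanSpace.single 2 1) 2) p₀.2 (EuclideanSpace.single 1 1) *
              fderiv ℝ (u p₀.1) p₀.2 (EuclideanSpace.single 0 1) 2 ≠ 0 →
        μ p₀.1 (p₀.2 2) ≠ 0 → μ p₀.1 (p₀.2 2) ≠ 1 → deriv (μ p₀.1) (p₀.2 2) ≠ 0 → False) := by
  intro h
  refine h (fun _ y => (toLp 2 ![3 / 2 * y 0 ^ 2 * y 1 * y 2 ^ 2 - 1 / 5 * y 1 * y 2 ^ 5,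
        1 / 2 * y 0 ^ 3 * y 2 ^ 2 - 1 / 5 * y 0 * y 2 ^ 5, y 0 ^ 3 * y 1 - y 0 * y 1 * y 2 ^ 3] : EuclideanSpace ℝ (Fin 3)))
    (fun _ z => z) (fun _ _ => 0) univ ((0 : ℝ), toLp 2 ![(1 : ℝ), 1, 2]) isOpen_univ (mem_univ _)
    (fun q _ => ((contDiff_field (n := ω)).contDiffAt.analyticAt).comp analyticAt_snd)
    (fun _ _ => analyticAt_snd) (fun _ _ => analyticAt_const) (fun p _ => ?_) (fun p _ => ?_) (fun p _ b hb => ?_)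
    (fun p _ i => ?_) ?_ ?_ ?_ ?_
  · -- poloidal `∂₀u₁ = ∂₁u₀`
    beta_reduce
    rw [fderiv_field_single, fderiv_field_single]
    simp
  · -- divergence free
    beta_reduce
    rw [fderiv_field_single, fderiv_field_single, fderiv_field_single]
    simp
  · -- proportional shear with slope `μ = y₂`
    beta_reduce
    fin_cases b
    · rw [fderiv_field_single, fderiv_field_single]; simp; ring
    · rw [fderiv_field_single, fderiv_field_single]; simp; ring
    · exact absurd rfl hb
  · -- the polynomial sector: on the slice `y₂ = c` every component is a polynomial in `(y₀, y₁)`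
    fin_cases i
    · refine ⟨MvPolynomial.C (3 / 2 * (p.2 2) ^ 2) * MvPolynomial.X 0 ^ 2 * MvPolynomial.X 1 -
        MvPolynomial.C (1 / 5 * (p.2 2) ^ 5) * MvPolynomial.X 1, fun q _ _ h2 => ?_⟩
      simp [h2]; ring
    · refine ⟨MvPolynomial.C (1 / 2 * (p.2 2) ^ 2) * MvPolynomial.X 0 ^ 3 -
        MvPolynomial.C (1 / 5 * (p.2 2) ^ 5) * MvPolynomial.X 0, fun q _ _ h2 => ?_⟩
      simp [h2]; ring
    · refine ⟨MvPolynomial.X 0 ^ 3 * MvPolynomial.X 1 - MvPolynomial.C ((p.2 2) ^ 3) * MvPolynomial.X 0 * MvPolynomial.X 1,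
        fun q _ _ h2 => ?_⟩
      simp [h2]; ring
  · -- the twist at `p₀ = (0,(1,1,2))` is `6·1·1·4 = 24 ≠ 0`
    beta_reduce
    rw [twist_field]
    simp
  · simp
  · simp
  · simp

end Summit.NavierStokesRegularity.NavierStokesRegularity.Theorems.PoloidalWindowRigidity.Negative

end
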